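import Summits.QuantumAdvantage.QuantumAdvantage.Theorems.CharDialSubRankA

/-! # CharDialSubRankB — part 2/4 (mechanical split for landing of `CharDialSubRank`; content verbatim; scopes re-opened with their variables) -/

noncomputable section
open Finset
open Summit.QuantumAdvantage.AdviceFreeQNC0 Summit.QuantumAdvantage.AdviceFreeQNC0.JLinPeel

namespace Summit.QuantumAdvantage.AdviceFreeQNC0.WindowCounter
open Summit.QuantumAdvantage.AdviceFreeQNC0 AffBells23

section GenBlock
variable (p : ℕ) [Fact p.Prime] {n m : ℕ}
variable (pat κ : Fin m → ℕ) (y : Fin m → (Fin n → Bool) → Bool) (J : Fin m → Finset (Fin n))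

/-- **the four-point exchange identity** for two separated blocks that no bell touches simultaneously. -/
theorem QfG_exchange (hJ : ∀ b u v, (∀ i ∈ J b, u i = v i) → y b u = y b v) (a : Fin n → ZMod p) (t : ZMod p)
    {k₀ k₁ : ℕ} (hk₀ : k₀ + 3 ≤ n) (hk₁ : k₁ + 3 ≤ n) (hsep : k₀ + 3 ≤ k₁ ∨ k₁ + 3 ≤ k₀)
    (hni : ∀ b, touchG pat J b k₀ = true → ¬ (touchG pat J b k₁ = true)) {X X' Y Y' : Fin 3 → Bool}
    (hX : wt X % 3 = wt X' % 3) (hY : wt Y % 3 = wt Y' % 3) (z : Fin n → Bool) :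
    QfG p pat κ y a t (setBlk k₁ Y (setBlk k₀ X' z)) * QfG p pat κ y a t (setBlk k₁ Y' (setBlk k₀ X z)) =
      QfG p pat κ y a t (setBlk k₁ Y (setBlk k₀ X z)) * QfG p pat κ y a t (setBlk k₁ Y' (setBlk k₀ X' z)) := by
  have hsg : ∀ b : Fin m,
      sgn (firesG pat κ y b (setBlk k₁ Y (setBlk k₀ X' z))) * sgn (firesG pat κ y b (setBlk k₁ Y' (setBlk k₀ X z))) =
      sgn (firesG pat κ y b (setBlk k₁ Y (setBlk k₀ X z))) * sgn (firesG pat κ y b (setBlk k₁ Y' (setBlk k₀ X' z))) := by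
    intro b
    by_cases h1 : touchG pat J b k₁ = true
    · have h0 : ¬ (touchG pat J b k₀ = true) := fun h => hni b h h1
      rw [setBlk_comm hsep.symm Y X', setBlk_comm hsep.symm Y' X, setBlk_comm hsep.symm Y X, setBlk_comm hsep.symm Y' X',
        firesG_setBlk_congr pat κ y J hJ hk₀ h0 hX.symm (setBlk k₁ Y z),
        firesG_setBlk_congr pat κ y J hJ hk₀ h0 hX (setBlk k₁ Y' z)]
    · rw [firesG_setBlk_congr pat κ y J hJ hk₁ h1 hY (setBlk k₀ X' z),
        firesG_setBlk_congr pat κ y J hJ hk₁ h1 hY.symm (setBlk k₀ X z), mul_comm]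
  have hF : (∏ b : Fin m, sgn (firesG pat κ y b (setBlk k₁ Y (setBlk k₀ X' z)))) *
      (∏ b : Fin m, sgn (firesG pat κ y b (setBlk k₁ Y' (setBlk k₀ X z)))) =
      (∏ b : Fin m, sgn (firesG pat κ y b (setBlk k₁ Y (setBlk k₀ X z)))) *
      (∏ b : Fin m, sgn (firesG pat κ y b (setBlk k₁ Y' (setBlk k₀ X' z)))) := by
    rw [← prod_mul_distrib, ← prod_mul_distrib]; exact prod_congr rfl fun b _ => hsg b
  have hL : linF p a (setBlk k₁ Y (setBlk k₀ X' z)) + linF p a (setBlk k₁ Y' (setBlk k₀ X z)) =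
      linF p a (setBlk k₁ Y (setBlk k₀ X z)) + linF p a (setBlk k₁ Y' (setBlk k₀ X' z)) := by
    have e1 := linF_setBlk p a k₁ hk₁ Y (setBlk k₀ X' z)
    have e2 := linF_setBlk p a k₁ hk₁ Y' (setBlk k₀ X z)
    have e3 := linF_setBlk p a k₁ hk₁ Y (setBlk k₀ X z)
    have e4 := linF_setBlk p a k₁ hk₁ Y' (setBlk k₀ X' z)
    have f1 := linF_setBlk p a k₀ hk₀ X' z
    have f2 := linF_setBlk p a k₀ hk₀ X z
    rw [getBlk_setBlk_of_sep hk₁ hsep.symm] at e1 e2 e3 e4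
    linear_combination e1 + e2 - e3 - e4
  unfold QfG
  calc _ = ((∏ b : Fin m, sgn (firesG pat κ y b (setBlk k₁ Y (setBlk k₀ X' z)))) *
        (∏ b : Fin m, sgn (firesG pat κ y b (setBlk k₁ Y' (setBlk k₀ X z))))) *
        (ZMod.stdAddChar (t * (linF p a (setBlk k₁ Y (setBlk k₀ X' z)) + linF p a (setBlk k₁ Y' (setBlk k₀ X z)))) : ℂ) := by
          rw [mul_add, AddChar.map_add_eq_mul]; ring
    _ = ((∏ b : Fin m, sgn (firesG pat κ y b (setBlk k₁ Y (setBlk k₀ X z)))) *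
        (∏ b : Fin m, sgn (firesG pat κ y b (setBlk k₁ Y' (setBlk k₀ X' z))))) *
        (ZMod.stdAddChar (t * (linF p a (setBlk k₁ Y (setBlk k₀ X z)) + linF p a (setBlk k₁ Y' (setBlk k₀ X' z)))) : ℂ) := by
          rw [hF, hL]
    _ = _ := by rw [mul_add, AddChar.map_add_eq_mul]; ring

/-- the contracting pair of a good block. -/
theorem norm_QfG_pair_le (a : Fin n → ZMod p) {t : ZMod p} {k : ℕ} (hk : k + 3 ≤ n) {X X' : Fin 3 → Bool}
    (hΔ : t * (blkF p a k X' - blkF p a k X) ≠ 0) (z : Fin n → Bool) :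
    ‖QfG p pat κ y a t (setBlk k X z) + QfG p pat κ y a t (setBlk k X' z)‖ ≤ betaF p := by
  obtain ⟨b, hb⟩ := exists_prod_sgn_eq (univ : Finset (Fin m)) (fun b => firesG pat κ y b (setBlk k X z))
  obtain ⟨b', hb'⟩ := exists_prod_sgn_eq (univ : Finset (Fin m)) (fun b => firesG pat κ y b (setBlk k X' z))
  have hlin : linF p a (setBlk k X' z) = linF p a (setBlk k X z) + (blkF p a k X' - blkF p a k X) := by
    have e1 := linF_setBlk p a k hk X z
    have e2 := linF_setBlk p a k hk X' z
    linear_combination e2 - e1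
  unfold QfG
  rw [hb, hb', hlin, mul_add t, AddChar.map_add_eq_mul]
  have := norm_pair_le (ZMod.stdAddChar (t * linF p a (setBlk k X z)) : ℂ)
    (ZMod.stdAddChar (t * (blkF p a k X' - blkF p a k X)) : ℂ) (norm_char _ _) (le_betaF p hΔ).1 (le_betaF p hΔ).2 b b'
  calc _ = ‖(ZMod.stdAddChar (t * linF p a (setBlk k X z)) : ℂ) * sgn b +
        (ZMod.stdAddChar (t * linF p a (setBlk k X z)) : ℂ) * (ZMod.stdAddChar (t * (blkF p a k X' - blkF p a k X)) : ℂ) *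
          sgn b'‖ := by ring_nf
    _ ≤ betaF p := this

/-- **the ratio property** of class-restricted multi-block sums (generalised game). -/
theorem msumG_ratio (hJ : ∀ b u v, (∀ i ∈ J b, u i = v i) → y b u = y b v) (a : Fin n → ZMod p) (t : ZMod p)
    {k₀ : ℕ} (hk₀ : k₀ + 3 ≤ n) {X X' : Fin 3 → Bool} (hXX : wt X % 3 = wt X' % 3) :
    ∀ (M : ℕ) (k cl : Fin M → ℕ), (∀ j, k j + 3 ≤ n) → (∀ j, k₀ + 3 ≤ k j ∨ k j + 3 ≤ k₀) →
      (∀ j j', j ≠ j' → k j + 3 ≤ k j' ∨ k j' + 3 ≤ k j) →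
      (∀ b j, touchG pat J b k₀ = true → ¬ (touchG pat J b (k j) = true)) →
      (∀ j, cl j < 3) → ∀ v : Fin n → Bool,
        msum (QfG p pat κ y a t) M k cl (setBlk k₀ X' v) * QfG p pat κ y a t (fill M k cl (setBlk k₀ X v)) =
          msum (QfG p pat κ y a t) M k cl (setBlk k₀ X v) * QfG p pat κ y a t (fill M k cl (setBlk k₀ X' v)) := by
  intro M; induction M with
  | zero => intro k cl _ _ _ _ _ v; simp only [msum_zero, fill_zero]; ring
  | succ M ih =>
    intro k cl hk hsep₀ hsep hni₀ hcl v
    have hk' : ∀ j : Fin M, Fin.tail k j + 3 ≤ n := fun j => hk j.succ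
    have hsep₀' : ∀ j : Fin M, k₀ + 3 ≤ Fin.tail k j ∨ Fin.tail k j + 3 ≤ k₀ := fun j => hsep₀ j.succ
    have hsep' : ∀ j j' : Fin M, j ≠ j' → Fin.tail k j + 3 ≤ Fin.tail k j' ∨ Fin.tail k j' + 3 ≤ Fin.tail k j :=
      fun j j' h => hsep j.succ j'.succ fun e => h (Fin.succ_inj.1 e)
    have hni₀' : ∀ b (j : Fin M), touchG pat J b k₀ = true → ¬ (touchG pat J b (Fin.tail k j) = true) :=
      fun b j => hni₀ b j.succ
    have hcl' : ∀ j : Fin M, Fin.tail cl j < 3 := fun j => hcl j.succ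
    have h0sep : ∀ j : Fin M, k 0 + 3 ≤ Fin.tail k j ∨ Fin.tail k j + 3 ≤ k 0 :=
      fun j => hsep 0 j.succ (Fin.succ_ne_zero j).symm
    have hfill : ∀ Z W : Fin 3 → Bool, fill M (Fin.tail k) (Fin.tail cl) (setBlk (k 0) W (setBlk k₀ Z v)) =
        setBlk (k 0) W (setBlk k₀ Z (fill M (Fin.tail k) (Fin.tail cl) v)) := fun Z W => by
      rw [fill_setBlk_comm W M _ _ h0sep, fill_setBlk_comm Z M _ _ hsep₀']
    rw [msum_succ, msum_succ, fill_succ, fill_succ, hfill X (rep (cl 0)), hfill X' (rep (cl 0)), sum_mul, sum_mul]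
    refine sum_congr rfl fun Y hY => ?_
    have hYc : wt Y % 3 = wt (rep (cl 0)) % 3 := by rw [mem_Cl.1 hY, wt_rep_mod (hcl 0)]
    have I := ih (Fin.tail k) (Fin.tail cl) hk' hsep₀' hsep' hni₀' hcl' (setBlk (k 0) Y v)
    rw [setBlk_comm (hsep₀ 0) X' Y v, setBlk_comm (hsep₀ 0) X Y v, hfill X Y, hfill X' Y] at I
    have E := QfG_exchange p pat κ y J hJ a t hk₀ (hk 0) (hsep₀ 0) (fun b hb => hni₀ b 0 hb) hXX hYc
      (fill M (Fin.tail k) (Fin.tail cl) v)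
    have hne := QfG_ne_zero p pat κ y a t (setBlk (k 0) Y (setBlk k₀ X (fill M (Fin.tail k) (Fin.tail cl) v)))
    have key : (msum (QfG p pat κ y a t) M (Fin.tail k) (Fin.tail cl) (setBlk (k 0) Y (setBlk k₀ X' v)) *
        QfG p pat κ y a t (setBlk (k 0) (rep (cl 0)) (setBlk k₀ X (fill M (Fin.tail k) (Fin.tail cl) v))) -
        msum (QfG p pat κ y a t) M (Fin.tail k) (Fin.tail cl) (setBlk (k 0) Y (setBlk k₀ X v)) *
        QfG p pat κ y a t (setBlk (k 0) (rep (cl 0)) (setBlk k₀ X' (fill M (Fin.tail k) (Fin.tail cl) v)))) *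
        QfG p pat κ y a t (setBlk (k 0) Y (setBlk k₀ X (fill M (Fin.tail k) (Fin.tail cl) v))) = 0 := by
      linear_combination (QfG p pat κ y a t (setBlk (k 0) (rep (cl 0)) (setBlk k₀ X (fill M (Fin.tail k) (Fin.tail cl) v)))) * I
        + (msum (QfG p pat κ y a t) M (Fin.tail k) (Fin.tail cl) (setBlk (k 0) Y (setBlk k₀ X v))) * E
    rcases mul_eq_zero.1 key with h | h
    · exact sub_eq_zero.1 h
    · exact absurd h hne

/-- **THE BLOCK-PRODUCT BOUND** on class-restricted sums (generalised game): `‖msum‖ ≤ ∏_j bcl_j`. -/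
theorem msumG_bound (hp : 5 ≤ p) (hJ : ∀ b u v, (∀ i ∈ J b, u i = v i) → y b u = y b v) (a : Fin n → ZMod p)
    {t : ZMod p} (ht : t ≠ 0) :
    ∀ (M : ℕ) (k cl : Fin M → ℕ), (∀ j, k j + 3 ≤ n) → (∀ j j', j ≠ j' → k j + 3 ≤ k j' ∨ k j' + 3 ≤ k j) →
      (∀ b j j', j ≠ j' → touchG pat J b (k j) = true → ¬ (touchG pat J b (k j') = true)) →
      (∀ j, aExt p a (k j) ≠ 0) → (∀ j, cl j < 3) →
      ∀ u : Fin n → Bool, ‖msum (QfG p pat κ y a t) M k cl u‖ ≤ ∏ j, bcl p a (k j) (cl j) := by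
  intro M; induction M with
  | zero => intro k cl _ _ _ _ _ u; simp [msum_zero, norm_QfG]
  | succ M ih =>
    intro k cl hk hsep hni hgd hcl u
    have hk' : ∀ j : Fin M, Fin.tail k j + 3 ≤ n := fun j => hk j.succ
    have hsep' : ∀ j j' : Fin M, j ≠ j' → Fin.tail k j + 3 ≤ Fin.tail k j' ∨ Fin.tail k j' + 3 ≤ Fin.tail k j :=
      fun j j' h => hsep j.succ j'.succ fun e => h (Fin.succ_inj.1 e)
    have hni' : ∀ b (j j' : Fin M), j ≠ j' → touchG pat J b (Fin.tail k j) = true →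
        ¬ (touchG pat J b (Fin.tail k j') = true) :=
      fun b j j' h => hni b j.succ j'.succ fun e => h (Fin.succ_inj.1 e)
    have hgd' : ∀ j : Fin M, aExt p a (Fin.tail k j) ≠ 0 := fun j => hgd j.succ
    have hcl' : ∀ j : Fin M, Fin.tail cl j < 3 := fun j => hcl j.succ
    have h0sep : ∀ j : Fin M, k 0 + 3 ≤ Fin.tail k j ∨ Fin.tail k j + 3 ≤ k 0 :=
      fun j => hsep 0 j.succ (Fin.succ_ne_zero j).symm
    have hni0 : ∀ b (j : Fin M), touchG pat J b (k 0) = true → ¬ (touchG pat J b (Fin.tail k j) = true) :=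
      fun b j => hni b 0 j.succ (Fin.succ_ne_zero j).symm
    have hT : ∀ X, ‖msum (QfG p pat κ y a t) M (Fin.tail k) (Fin.tail cl) (setBlk (k 0) X u)‖ ≤
        ∏ j : Fin M, bcl p a (Fin.tail k j) (Fin.tail cl j) := fun X => ih _ _ hk' hsep' hni' hgd' hcl' _
    have hB0 : 0 ≤ ∏ j : Fin M, bcl p a (Fin.tail k j) (Fin.tail cl j) := le_trans (norm_nonneg _) (hT fun _ => false)
    rw [msum_succ, Fin.prod_univ_succ]
    show _ ≤ bcl p a (k 0) (cl 0) * ∏ j : Fin M, bcl p a (Fin.tail k j) (Fin.tail cl j)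
    by_cases hc0 : cl 0 = wt (XF p a (k 0)) % 3
    · have hX₀ : XF p a (k 0) ∈ Cl (cl 0) := mem_Cl.2 hc0.symm
      have hwt : wt (XF p a (k 0)) % 3 = wt (XF' p a (k 0)) % 3 := wt_XF_mod p a (k 0)
      have hX₀' : XF' p a (k 0) ∈ (Cl (cl 0)).erase (XF p a (k 0)) :=
        mem_erase.2 ⟨XF'_ne p a (k 0), mem_Cl.2 (by rw [← hwt]; exact hc0.symm)⟩
      have I := msumG_ratio p pat κ y J hJ a t (hk 0) hwt M (Fin.tail k) (Fin.tail cl) hk' h0sep hsep' hni0 hcl' u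
      rw [fill_setBlk_comm (XF p a (k 0)) M _ _ h0sep, fill_setBlk_comm (XF' p a (k 0)) M _ _ h0sep] at I
      have hq := norm_QfG p pat κ y a t (setBlk (k 0) (XF p a (k 0)) (fill M (Fin.tail k) (Fin.tail cl) u))
      have hqq := norm_QfG_pair_le p pat κ y a (hk 0) (blkF_pair p hp a ht (hgd 0)) (fill M (Fin.tail k) (Fin.tail cl) u)
      have hpair : ‖msum (QfG p pat κ y a t) M (Fin.tail k) (Fin.tail cl) (setBlk (k 0) (XF p a (k 0)) u) +
          msum (QfG p pat κ y a t) M (Fin.tail k) (Fin.tail cl) (setBlk (k 0) (XF' p a (k 0)) u)‖ ≤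
          betaF p * ∏ j : Fin M, bcl p a (Fin.tail k j) (Fin.tail cl j) := by
        have e : (msum (QfG p pat κ y a t) M (Fin.tail k) (Fin.tail cl) (setBlk (k 0) (XF p a (k 0)) u) +
            msum (QfG p pat κ y a t) M (Fin.tail k) (Fin.tail cl) (setBlk (k 0) (XF' p a (k 0)) u)) *
            QfG p pat κ y a t (setBlk (k 0) (XF p a (k 0)) (fill M (Fin.tail k) (Fin.tail cl) u)) =
            msum (QfG p pat κ y a t) M (Fin.tail k) (Fin.tail cl) (setBlk (k 0) (XF p a (k 0)) u) *
            (QfG p pat κ y a t (setBlk (k 0) (XF p a (k 0)) (fill M (Fin.tail k) (Fin.tail cl) u)) +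
              QfG p pat κ y a t (setBlk (k 0) (XF' p a (k 0)) (fill M (Fin.tail k) (Fin.tail cl) u))) := by
          linear_combination I
        have he := congrArg (fun z : ℂ => ‖z‖) e
        simp only [norm_mul, hq, mul_one] at he
        rw [he]
        calc _ ≤ (∏ j : Fin M, bcl p a (Fin.tail k j) (Fin.tail cl j)) * betaF p :=
              mul_le_mul (hT _) hqq (norm_nonneg _) hB0
          _ = _ := mul_comm _ _
      rw [← add_sum_erase _ _ hX₀, ← add_sum_erase _ _ hX₀', ← add_assoc]
      have h2 : 2 ≤ (Cl (cl 0)).card := by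
        have h1 : 1 ≤ ((Cl (cl 0)).erase (XF p a (k 0))).card := card_pos.2 ⟨_, hX₀'⟩
        rw [card_erase_of_mem hX₀] at h1
        omega
      have hcard : (((Cl (cl 0)).erase (XF p a (k 0))).erase (XF' p a (k 0))).card = (Cl (cl 0)).card - 2 := by
        rw [card_erase_of_mem hX₀', card_erase_of_mem hX₀]; omega
      calc _ ≤ ‖msum (QfG p pat κ y a t) M (Fin.tail k) (Fin.tail cl) (setBlk (k 0) (XF p a (k 0)) u) +
            msum (QfG p pat κ y a t) M (Fin.tail k) (Fin.tail cl) (setBlk (k 0) (XF' p a (k 0)) u)‖ +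
            ∑ X ∈ ((Cl (cl 0)).erase (XF p a (k 0))).erase (XF' p a (k 0)),
              ‖msum (QfG p pat κ y a t) M (Fin.tail k) (Fin.tail cl) (setBlk (k 0) X u)‖ :=
            (norm_add_le _ _).trans (by gcongr; exact norm_sum_le _ _)
        _ ≤ betaF p * (∏ j : Fin M, bcl p a (Fin.tail k j) (Fin.tail cl j)) +
            ∑ X ∈ ((Cl (cl 0)).erase (XF p a (k 0))).erase (XF' p a (k 0)),
              ∏ j : Fin M, bcl p a (Fin.tail k j) (Fin.tail cl j) := add_le_add hpair (sum_le_sum fun X _ => hT X)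
        _ = (((Cl (cl 0)).card : ℝ) - 2 + betaF p) * ∏ j : Fin M, bcl p a (Fin.tail k j) (Fin.tail cl j) := by
            rw [sum_const, hcard, nsmul_eq_mul, Nat.cast_sub h2]; push_cast; ring
        _ = bcl p a (k 0) (cl 0) * ∏ j : Fin M, bcl p a (Fin.tail k j) (Fin.tail cl j) := by
            rw [bcl, if_pos hc0]; ring
    · calc _ ≤ ∑ X ∈ Cl (cl 0), ‖msum (QfG p pat κ y a t) M (Fin.tail k) (Fin.tail cl) (setBlk (k 0) X u)‖ :=
            norm_sum_le _ _
        _ ≤ ∑ X ∈ Cl (cl 0), ∏ j : Fin M, bcl p a (Fin.tail k j) (Fin.tail cl j) := sum_le_sum fun X _ => hT X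
        _ = bcl p a (k 0) (cl 0) * ∏ j : Fin M, bcl p a (Fin.tail k j) (Fin.tail cl j) := by
            rw [sum_const, nsmul_eq_mul, bcl, if_neg hc0, sub_zero]

/-- **THE BLOCK PRODUCT THEOREM for the generalised game.** -/
theorem norm_sum_QfG_le (hp : 5 ≤ p) (hJ : ∀ b u v, (∀ i ∈ J b, u i = v i) → y b u = y b v) (a : Fin n → ZMod p)
    {t : ZMod p} (ht : t ≠ 0) (M : ℕ) (k : Fin M → ℕ) (hk : ∀ j, k j + 3 ≤ n)
    (hsep : ∀ j j', j ≠ j' → k j + 3 ≤ k j' ∨ k j' + 3 ≤ k j)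
    (hni : ∀ b j j', j ≠ j' → touchG pat J b (k j) = true → ¬ (touchG pat J b (k j') = true))
    (hgd : ∀ j, aExt p a (k j) ≠ 0) :
    ‖∑ u, QfG p pat κ y a t u‖ ≤ 2 ^ n * kappaF p ^ M := by
  have havg := sum_msum_avg (QfG p pat κ y a t) M k hk
  have h8 : (8 : ℂ) ^ M ≠ 0 := pow_ne_zero _ (by norm_num)
  have hS : ∑ u, QfG p pat κ y a t u =
      (∑ cv : Fin M → Fin 3, ∑ u, msum (QfG p pat κ y a t) M k (fun j => (cv j).val) u) / 8 ^ M := by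
    rw [havg]; field_simp
  have hbd : ‖∑ cv : Fin M → Fin 3, ∑ u, msum (QfG p pat κ y a t) M k (fun j => (cv j).val) u‖ ≤
      2 ^ n * (6 + betaF p) ^ M := by
    calc _ ≤ ∑ cv : Fin M → Fin 3, ∑ u : Fin n → Bool, ∏ j, bcl p a (k j) (cv j).val := by
          refine (norm_sum_le _ _).trans (sum_le_sum fun cv _ => (norm_sum_le _ _).trans (sum_le_sum fun u _ => ?_))
          exact msumG_bound p pat κ y J hp hJ a ht M k _ hk hsep hni hgd (fun j => (cv j).isLt) u
      _ = 2 ^ n * ∑ cv : Fin M → Fin 3, ∏ j, bcl p a (k j) (cv j).val := by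
          rw [mul_sum]; refine sum_congr rfl fun cv _ => ?_
          rw [sum_const, card_univ, Fintype.card_fun, Fintype.card_bool, Fintype.card_fin, nsmul_eq_mul]; push_cast; ring
      _ = 2 ^ n * ∏ j : Fin M, ∑ c₀ : Fin 3, bcl p a (k j) c₀.val := by
          rw [Finset.prod_univ_sum (fun _ => (univ : Finset (Fin 3))) (fun j c₀ => bcl p a (k j) c₀.val),
            Fintype.piFinset_univ]
      _ = 2 ^ n * (6 + betaF p) ^ M := by
          rw [prod_congr rfl fun j _ => sum_bcl p a (k j), prod_const, card_univ, Fintype.card_fin]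
  have h8n : ‖(8 : ℂ) ^ M‖ = 8 ^ M := by simp
  rw [hS, norm_div, h8n, div_le_iff₀ (by positivity), kappaF, div_pow, mul_div_assoc', div_mul_cancel₀ _ (by positivity)]
  exact hbd

/-! ### block selection for the generalised game: `Σ deg ≤ m·(L+1)²` -/

/-- two blocks INTERACT: some bell touches both. -/
def adjTG (k k' : ℕ) : Bool := decide (∃ b : Fin m, touchG pat J b k = true ∧ touchG pat J b k' = true)

/-- CharDialSubRankB helper `adjTG_symm` (decomp-qadv land package; see the module docstring). -/
theorem adjTG_symm (k k' : ℕ) (h : adjTG pat J k k' = true) : adjTG pat J k' k = true := by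
  unfold adjTG at h ⊢; rw [decide_eq_true_eq] at h ⊢
  obtain ⟨b, h1, h2⟩ := h; exact ⟨b, h2, h1⟩

/-- a bell touches at most `L + 1` pairwise separated blocks. -/
theorem card_touchG_le {L : ℕ} (hJc : ∀ b, (J b).card ≤ L) (T : Finset ℕ)
    (hsep : ∀ k ∈ T, ∀ k' ∈ T, k ≠ k' → k + 3 ≤ k' ∨ k' + 3 ≤ k) (b : Fin m) :
    (T.filter fun k => touchG pat J b k = true).card ≤ L + 1 := by
  classical
  have h1 : (T.filter fun k => ∃ i ∈ J b, k ≤ i.val ∧ i.val < k + 3).card ≤ L := by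
    calc _ ≤ ((J b).biUnion fun i => T.filter fun k => k ≤ i.val ∧ i.val < k + 3).card := card_le_card (by
            intro k hk; rw [mem_filter] at hk; rw [mem_biUnion]
            obtain ⟨i, hi, h⟩ := hk.2; exact ⟨i, hi, mem_filter.2 ⟨hk.1, h⟩⟩)
      _ ≤ ∑ i ∈ J b, (T.filter fun k => k ≤ i.val ∧ i.val < k + 3).card := card_biUnion_le
      _ ≤ ∑ i ∈ J b, 1 := sum_le_sum fun i _ => Finset.card_le_one.2 fun k hk k' hk' => by
          rw [mem_filter] at hk hk'
          by_contra hne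
          rcases hsep k hk.1 k' hk'.1 hne with h | h <;> omega
      _ ≤ L := by rw [sum_const, smul_eq_mul, mul_one]; exact hJc b
  have h2 : (T.filter fun k => pat b = k + 1 ∨ pat b = k + 2).card ≤ 1 := Finset.card_le_one.2 fun k hk k' hk' => by
    rw [mem_filter] at hk hk'
    by_contra hne
    rcases hsep k hk.1 k' hk'.1 hne with h | h <;> omega
  calc _ ≤ ((T.filter fun k => ∃ i ∈ J b, k ≤ i.val ∧ i.val < k + 3) ∪
        (T.filter fun k => pat b = k + 1 ∨ pat b = k + 2)).card := card_le_card (by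
          intro k hk; rw [mem_filter] at hk; rw [mem_union, mem_filter, mem_filter]
          have h := hk.2; unfold touchG at h; rw [decide_eq_true_eq] at h
          rcases h with h | h
          · exact Or.inl ⟨hk.1, h⟩
          · exact Or.inr ⟨hk.1, h⟩)
    _ ≤ _ := (card_union_le _ _).trans (add_le_add h1 h2)

/-- **degree sum of the interaction graph**: `Σ_k deg k ≤ Σ_b τ_b² ≤ m·(L+1)²`. -/
theorem sum_degG_le {L : ℕ} (hJc : ∀ b, (J b).card ≤ L) (T : Finset ℕ)
    (hsep : ∀ k ∈ T, ∀ k' ∈ T, k ≠ k' → k + 3 ≤ k' ∨ k' + 3 ≤ k) :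
    ∑ k ∈ T, (T.filter fun k' => k' ≠ k ∧ adjTG pat J k k' = true).card ≤ m * (L + 1) ^ 2 := by
  classical
  set τ : Fin m → ℕ := fun b => (T.filter fun k => touchG pat J b k = true).card with hτ
  have hdeg : ∀ k ∈ T, (T.filter fun k' => k' ≠ k ∧ adjTG pat J k k' = true).card ≤
      ∑ b ∈ univ.filter (fun b : Fin m => touchG pat J b k = true), τ b := fun k _ => by
    calc _ ≤ ((univ.filter fun b : Fin m => touchG pat J b k = true).biUnion
          fun b => T.filter fun k' => touchG pat J b k' = true).card := card_le_card (by
            intro k' hk'; rw [mem_filter] at hk'; rw [mem_biUnion]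
            have h := hk'.2.2; unfold adjTG at h; rw [decide_eq_true_eq] at h
            obtain ⟨b, hb1, hb2⟩ := h
            exact ⟨b, mem_filter.2 ⟨mem_univ _, hb1⟩, mem_filter.2 ⟨hk'.1, hb2⟩⟩)
      _ ≤ _ := card_biUnion_le
  calc _ ≤ ∑ k ∈ T, ∑ b ∈ univ.filter (fun b : Fin m => touchG pat J b k = true), τ b := sum_le_sum hdeg
    _ = ∑ k ∈ T, ∑ b : Fin m, if touchG pat J b k = true then τ b else 0 :=
        sum_congr rfl fun k _ => sum_filter _ _
    _ = ∑ b : Fin m, ∑ k ∈ T, if touchG pat J b k = true then τ b else 0 := sum_comm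
    _ = ∑ b : Fin m, τ b * τ b := sum_congr rfl fun b _ => by rw [← sum_filter, sum_const, smul_eq_mul]
    _ ≤ ∑ b : Fin m, (L + 1) * (L + 1) :=
        sum_le_sum fun b _ => Nat.mul_le_mul (card_touchG_le pat J hJc T hsep b) (card_touchG_le pat J hJc T hsep b)
    _ = m * (L + 1) ^ 2 := by rw [sum_const, card_univ, Fintype.card_fin, smul_eq_mul]; ring

/-- **BLOCK SELECTION** (generalised game): `|T|² ≤ 2M·(2m(L+1)² + |T|)` non-interacting blocks. -/
theorem exists_blocksG {L : ℕ} (hJc : ∀ b, (J b).card ≤ L) (T : Finset ℕ)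
    (hsep : ∀ k ∈ T, ∀ k' ∈ T, k ≠ k' → k + 3 ≤ k' ∨ k' + 3 ≤ k) :
    ∃ (M : ℕ) (k : Fin M → ℕ), (∀ j, k j ∈ T) ∧ (∀ j j', j ≠ j' → k j ≠ k j') ∧
      (∀ b j j', j ≠ j' → touchG pat J b (k j) = true → ¬ (touchG pat J b (k j') = true)) ∧
      T.card ^ 2 ≤ 2 * M * (2 * (m * (L + 1) ^ 2) + T.card) := by
  classical
  rcases Nat.eq_zero_or_pos T.card with hT0 | hTpos
  · exact ⟨0, Fin.elim0, fun j => j.elim0, fun j => j.elim0, fun _ j => j.elim0, by rw [hT0]; simp⟩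
  set MM := m * (L + 1) ^ 2 with hMM
  set deg : ℕ → ℕ := fun k => (T.filter fun k' => k' ≠ k ∧ adjTG pat J k k' = true).card with hdegdef
  have hsum : ∑ k ∈ T, deg k ≤ MM := sum_degG_le pat J hJc T hsep
  set D := 2 * MM / T.card with hD
  set light := T.filter fun k => deg k ≤ D with hlight
  have hsplit := Finset.card_filter_add_card_filter_not (s := T) (fun k => deg k ≤ D)
  have hheavy : 2 * (T.filter fun k => ¬ deg k ≤ D).card < T.card := by
    have h1 : (T.filter fun k => ¬ deg k ≤ D).card * (D + 1) ≤ MM := by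
      calc _ = ∑ k ∈ T.filter (fun k => ¬ deg k ≤ D), (D + 1) := by rw [sum_const, smul_eq_mul]
        _ ≤ ∑ k ∈ T.filter (fun k => ¬ deg k ≤ D), deg k := sum_le_sum fun k hk => by
            have := (mem_filter.1 hk).2; omega
        _ ≤ ∑ k ∈ T, deg k := sum_le_sum_of_subset (filter_subset _ _)
        _ ≤ MM := hsum
    have h2 : 2 * MM < (D + 1) * T.card := by
      have := Nat.lt_div_mul_add (a := 2 * MM) hTpos
      rw [hD]; linarith
    have h4 : (D + 1) * (2 * (T.filter fun k => ¬ deg k ≤ D).card) < (D + 1) * T.card := by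
      calc (D + 1) * (2 * (T.filter fun k => ¬ deg k ≤ D).card) = 2 * ((T.filter fun k => ¬ deg k ≤ D).card * (D + 1)) := by ring
        _ ≤ 2 * MM := by omega
        _ < (D + 1) * T.card := h2
    exact Nat.lt_of_mul_lt_mul_left h4
  have hlight2 : T.card ≤ 2 * light.card := by
    have : light.card = (T.filter fun k => deg k ≤ D).card := by rw [hlight]
    omega
  have hdegL : ∀ k ∈ light, (light.filter fun k' => k' ≠ k ∧ adjTG pat J k k' = true).card ≤ D := fun k hk =>
    le_trans (card_le_card (filter_subset_filter _ (filter_subset _ _))) (mem_filter.1 hk).2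
  obtain ⟨I, hIl, hind, hIcard⟩ := exists_indep (adjTG pat J) (adjTG_symm pat J) D light.card light le_rfl hdegL
  have hIT : I ⊆ T := hIl.trans (filter_subset _ _)
  refine ⟨I.card, fun j => I.orderEmbOfFin rfl j, fun j => hIT (orderEmbOfFin_mem I rfl j),
    fun j j' h e => h ((I.orderEmbOfFin rfl).injective e), fun b j j' hjj h1 h2 => ?_, ?_⟩
  · have hne : I.orderEmbOfFin rfl j ≠ I.orderEmbOfFin rfl j' := fun e => hjj ((I.orderEmbOfFin rfl).injective e)
    refine hind _ (orderEmbOfFin_mem I rfl j) _ (orderEmbOfFin_mem I rfl j') hne ?_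
    unfold adjTG; rw [decide_eq_true_eq]; exact ⟨b, h1, h2⟩
  · have hDT : D * T.card ≤ 2 * MM := by rw [hD]; exact Nat.div_mul_le_self _ _
    calc T.card ^ 2 = T.card * T.card := sq _
      _ ≤ (2 * ((D + 1) * I.card)) * T.card := Nat.mul_le_mul_right _ (hlight2.trans (Nat.mul_le_mul_left _ hIcard))
      _ = 2 * I.card * (D * T.card + T.card) := by ring
      _ ≤ 2 * I.card * (2 * MM + T.card) := Nat.mul_le_mul_left _ (by omega)

end GenBlock

section FormJuntaG

variable (p : ℕ) [Fact p.Prime]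


end FormJuntaG
end Summit.QuantumAdvantage.AdviceFreeQNC0.WindowCounter
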